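import Summits.Ventures.PercRepro.C025ProfileFourCapETripleA
import Summits.Ventures.PercRepro.C025ProfileFourCapETripleC
/-!
# (Cap) OF RULE E — `|S| = 5` with a collinear triple: the parameters and the shares (night-3 g10)
NIGHT3-G10-CAPE-PROOF.md §4, second part. With `L₀ = cl T₀` (`ℓ` points), `F₀ = E ∖ L₀` (`f` points, rank `q`),
`N = |G_{T₀}|`: the constraints `R − 2 ≤ f`, `R − 2 ≤ q ≤ min(f, R)`, `C(R−2,2) + (f−R+2)(R−3) ≤ N ≤ C(f,2)`
(`card_Fs_ge_of_triple`, `q_bounds`, `card_Gfam_triple_bounds`); the coranks `crk T₀ ≤ pZero`, `crk B ≤ pIn` for the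
inner pairs (`crk_triple_le`, `crk_inner_le`); the FAT share `≤ [4 ≤ p₀]·C(p₀,2)/(6·C(f,2))` (`wE_triple_le`:
`S ∖ T₀ ∈ G_{T₀}` and `|G ∪ P| ≥ C(f,2)`) and each INNER share `≤ (C(p,2) − N)⁺/(6(ℓ−2)N)` (`wE_inner_le`:
`G_B = G_{T₀}`, `S ∖ B ∈ Ls_B`, `|Ls_B| = (ℓ−2)·N`).
-/
open scoped Matroid
namespace PercRepro
open Set Finset ThmH CapEArith
section CapETripleB
variable {α : Type} [DecidableEq α] {M : Matroid α} [M.Finite]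

/-- The ground set is the line of `T₀` together with `F_{T₀}`. -/
theorem mem_clF_or_mem_Fs (B : Finset α) {w : α} (hw : w ∈ gr M) : w ∈ clF M B ∨ w ∈ Fs M B := by
  by_cases h : w ∈ clF M B
  · exact Or.inl h
  · exact Or.inr (mem_Fs.2 ⟨hw, h⟩)

omit [DecidableEq α] in
/-- The rank of a subset of a line is at most `2`, and at most its cardinality. -/
theorem eRk_subset_clF_le {B X : Finset α} (hB2 : M.eRk (B : Set α) = 2) (hX : X ⊆ clF M B) :
    M.eRk (X : Set α) ≤ (min X.card 2 : ℕ) := by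
  have h1 : M.eRk (X : Set α) ≤ 2 := by
    have := M.eRk_mono (Finset.coe_subset.2 hX)
    rwa [coe_clF, M.eRk_closure_eq, hB2] at this
  have h2 := eRk_le_card (M := M) X
  rcases Nat.le_total X.card 2 with h | h
  · rw [min_eq_left h]; exact h2
  · rw [min_eq_right h]; exact h1

/-- `F_{T₀}` has at least `R − 2` points. -/
theorem card_Fs_ge_of_triple {R : ℕ} (hR : M.eRank = R) {T₀ : Finset α} (hT : T₀ ∈ Profile.Rq M 2) :
    R - 2 ≤ (Fs M T₀).card := by
  obtain ⟨hTg, hT2⟩ := Profile.mem_Rq.1 hT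
  have h := eRank_le_eRk_union_Fs (M := M) hTg
  rw [hR, Finset.coe_union] at h
  have h2 := (M.eRk_union_le_eRk_add_eRk (T₀ : Set α) ((Fs M T₀ : Finset α) : Set α)).trans
    (add_le_add (le_of_eq hT2) (eRk_le_card _))
  have h3 : (R : ℕ∞) ≤ 2 + ((Fs M T₀).card : ℕ∞) := h.trans h2
  have : R ≤ 2 + (Fs M T₀).card := by exact_mod_cast h3
  omega

/-- The rank `q` of `F_{T₀}` as a natural number: `R − 2 ≤ q ≤ min(f, R)`, and `ρ(F₀) = q`. -/
theorem q_bounds {R : ℕ} (hR : M.eRank = R) {T₀ : Finset α} (hT : T₀ ∈ Profile.Rq M 2) :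
    M.eRk ((Fs M T₀ : Finset α) : Set α) = ((M.eRk ((Fs M T₀ : Finset α) : Set α)).toNat : ℕ∞) ∧
      R - 2 ≤ (M.eRk ((Fs M T₀ : Finset α) : Set α)).toNat ∧
      (M.eRk ((Fs M T₀ : Finset α) : Set α)).toNat ≤ (Fs M T₀).card ∧
      (M.eRk ((Fs M T₀ : Finset α) : Set α)).toNat ≤ R := by
  obtain ⟨hTg, hT2⟩ := Profile.mem_Rq.1 hT
  have hfin : M.eRk ((Fs M T₀ : Finset α) : Set α) ≠ ⊤ := (M.isRkFinite_set _).eRk_lt_top.ne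
  have hq := (ENat.coe_toNat hfin).symm
  refine ⟨hq, ?_, ?_, ?_⟩
  · have h := eRank_le_eRk_union_Fs (M := M) hTg
    rw [hR, Finset.coe_union] at h
    have h2 := (M.eRk_union_le_eRk_add_eRk (T₀ : Set α) ((Fs M T₀ : Finset α) : Set α)).trans
      (add_le_add (le_of_eq hT2) (le_of_eq hq))
    have h3 : (R : ℕ∞) ≤ 2 + ((M.eRk ((Fs M T₀ : Finset α) : Set α)).toNat : ℕ∞) := h.trans h2
    have : R ≤ 2 + (M.eRk ((Fs M T₀ : Finset α) : Set α)).toNat := by exact_mod_cast h3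
    omega
  · have h := eRk_le_card (M := M) (Fs M T₀)
    rw [hq] at h
    exact_mod_cast h
  · have h : M.eRk ((Fs M T₀ : Finset α) : Set α) ≤ M.eRank := by
      rw [M.eRank_def, ← coe_gr]; exact M.eRk_mono (Finset.coe_subset.2 (Fs_subset_gr T₀))
    rw [hq, hR] at h
    exact_mod_cast h

/-- `C(R−2,2) + (f − R + 2)(R − 3) ≤ N ≤ C(f,2)`. -/
theorem card_Gfam_triple_bounds {R : ℕ} (hR : M.eRank = R) {T₀ : Finset α} (hT : T₀ ∈ Profile.Rq M 2) :
    Nat.choose (R - 2) 2 + ((Fs M T₀).card - (R - 2)) * (R - 3) ≤ (Gfam M T₀).card ∧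
      (Gfam M T₀).card ≤ Nat.choose (Fs M T₀).card 2 := by
  refine ⟨card_Gfam_ge hR hT, ?_⟩
  rw [← Finset.card_powersetCard 2 (Fs M T₀)]
  apply Finset.card_le_card
  intro Y hY
  rw [Finset.mem_powersetCard]
  exact ⟨(mem_Gfam.1 hY).1, (mem_Gfam.1 hY).2.1⟩

/-- `crk B ≤ q + min(|L₀ ∖ B|, 2)` (`E ∖ B ⊆ F₀ ∪ (L₀ ∖ B)`). -/
theorem crk_le_q_add {T₀ : Finset α} (B : Finset α) (hT : T₀ ∈ Profile.Rq M 2) :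
    crk M B ≤ (M.eRk ((Fs M T₀ : Finset α) : Set α)).toNat + min (clF M T₀ \ B).card 2 := by
  obtain ⟨hTg, hT2⟩ := Profile.mem_Rq.1 hT
  have hfin : M.eRk ((Fs M T₀ : Finset α) : Set α) ≠ ⊤ := (M.isRkFinite_set _).eRk_lt_top.ne
  have hq := (ENat.coe_toNat hfin).symm
  apply crk_le_of_subset_union (X := Fs M T₀) (Y := clF M T₀ \ B)
  · intro w hw
    rw [Finset.mem_sdiff] at hw
    rw [Finset.mem_union]
    rcases mem_clF_or_mem_Fs T₀ hw.1 with h | h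
    · exact Or.inr (Finset.mem_sdiff.2 ⟨h, hw.2⟩)
    · exact Or.inl h
  · exact le_of_eq hq
  · exact eRk_subset_clF_le hT2 Finset.sdiff_subset

/-- The corank of the triple is at most `pZero`. -/
theorem crk_triple_le {R : ℕ} (hR : M.eRank = R) {T₀ : Finset α} (hT : T₀ ∈ Profile.Rq M 2) (hTc : T₀.card = 3) :
    crk M T₀ ≤ pZero R (clF M T₀).card ((M.eRk ((Fs M T₀ : Finset α) : Set α)).toNat) := by
  obtain ⟨hTg, _⟩ := Profile.mem_Rq.1 hT
  unfold pZero
  apply le_min (crk_le_eRank hR T₀)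
  have h := crk_le_q_add T₀ hT
  rwa [Finset.card_sdiff_of_subset (subset_clF_self hTg), hTc] at h

/-- An inner pair has the line of the triple, and the corank of an inner pair is at most `pIn`. -/
theorem crk_inner_le {R : ℕ} (hR : M.eRank = R) (hsimple : ∀ T ⊆ M.E, T.encard ≤ 2 → M.Indep T)
    {T₀ B : Finset α} (hT : T₀ ∈ Profile.Rq M 2) (hB : B ⊆ T₀) (hBc : B.card = 2) :
    clF M B = clF M T₀ ∧
      crk M B ≤ pIn R (clF M T₀).card ((M.eRk ((Fs M T₀ : Finset α) : Set α)).toNat) := by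
  obtain ⟨hTg, hT2⟩ := Profile.mem_Rq.1 hT
  have hcl : clF M B = clF M T₀ := by
    obtain ⟨x, y, hxy, rfl⟩ := Finset.card_eq_two.1 hBc
    exact clF_pair_eq_of_subset_line hsimple hTg hT2 hxy (hB (Finset.mem_insert_self _ _))
      (hB (Finset.mem_insert_of_mem (Finset.mem_singleton_self _)))
  refine ⟨hcl, ?_⟩
  unfold pIn
  apply le_min (crk_le_eRank hR B)
  have h := crk_le_q_add B hT
  rwa [Finset.card_sdiff_of_subset (hB.trans (subset_clF_self hTg)), hBc] at h

/-- `G_B = G_{T₀}` for an inner pair `B` (same line, same rank conditions). -/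
theorem Gfam_inner_eq {T₀ B : Finset α} (hcl : clF M B = clF M T₀) : Gfam M B = Gfam M T₀ := by
  have hFs : Fs M B = Fs M T₀ := by unfold Fs; rw [hcl]
  have hrk : ∀ Y : Finset α, M.eRk ((B ∪ Y : Finset α) : Set α) = M.eRk ((T₀ ∪ Y : Finset α) : Set α) := by
    intro Y
    rw [Finset.coe_union, ← M.eRk_union_closure_left_eq, ← coe_clF, hcl, coe_clF, M.eRk_union_closure_left_eq,
      ← Finset.coe_union]
  unfold Gfam
  rw [hFs]
  apply Finset.filter_congr
  intro Y _
  rw [hrk Y]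

/-- `|Ls_B| = |cl B ∖ B| · |G_B|`. -/
theorem card_Lfam_eq (B : Finset α) : (Lfam M B).card = (clF M B \ B).card * (Gfam M B).card := by
  unfold Lfam
  rw [Finset.card_image_of_injOn, Finset.card_product]
  rintro ⟨u, Y⟩ hp ⟨u', Y'⟩ hp' heq
  rw [Finset.mem_coe, Finset.mem_product] at hp hp'
  simp only at heq
  have hYF : Y ⊆ Fs M B := (mem_Gfam.1 hp.2).1
  have hY'F : Y' ⊆ Fs M B := (mem_Gfam.1 hp'.2).1
  have hu : u ∈ clF M B := (Finset.mem_sdiff.1 hp.1).1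
  have hu' : u' ∈ clF M B := (Finset.mem_sdiff.1 hp'.1).1
  have huY' : u ∉ Y' := fun h => (mem_Fs.1 (hY'F h)).2 hu
  have hu'Y : u' ∉ Y := fun h => (mem_Fs.1 (hYF h)).2 hu'
  have huu' : u = u' := by
    have : u ∈ insert u' Y' := by rw [← heq]; exact Finset.mem_insert_self _ _
    rw [Finset.mem_insert] at this
    rcases this with h | h
    · exact h
    · exact absurd h huY'
  subst huu'
  have hYY' : Y = Y' := by
    have h1 : Y = (insert u Y).erase u := by rw [Finset.erase_insert (fun h => (mem_Fs.1 (hYF h)).2 hu)]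
    have h2 : Y' = (insert u Y').erase u := by rw [Finset.erase_insert huY']
    rw [h1, h2, heq]
  rw [hYY']

/-- **The fat share of the triple**: `≤ [4 ≤ p₀]·C(p₀,2)/(6·C(f,2))`. -/
theorem wE_triple_le {R : ℕ} (hR : M.eRank = R) (h5R : 5 ≤ R) {S T₀ : Finset α} (hS : S ∈ Shadow.levelSet M 4)
    (h5 : S.card = 5) (hT : T₀ ⊆ S) (hTc : T₀.card = 3) (hT2 : M.eRk (T₀ : Set α) = 2) :
    wE M T₀ S ≤ if 4 ≤ pZero R (clF M T₀).card ((M.eRk ((Fs M T₀ : Finset α) : Set α)).toNat) then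
      ((Nat.choose (pZero R (clF M T₀).card ((M.eRk ((Fs M T₀ : Finset α) : Set α)).toNat)) 2 : ℕ) : ℚ) /
        (6 * ((Nat.choose (Fs M T₀).card 2 : ℕ) : ℚ)) else 0 := by
  obtain ⟨hSg, hS4⟩ := Profile.mem_levelSet.1 hS
  have hTq : T₀ ∈ Profile.Rq M 2 := Profile.mem_Rq.2 ⟨hT.trans hSg, hT2⟩
  have hG := sdiff_mem_Gfam_of_triple hS h5 hT hTc hT2
  have hp := crk_triple_le hR hTq hTc
  set p₀ := pZero R (clF M T₀).card ((M.eRk ((Fs M T₀ : Finset α) : Set α)).toNat) with hp₀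
  -- `|G ∪ P| ≥ C(f, 2)`
  have hGP : Nat.choose (Fs M T₀).card 2 ≤ (Gfam M T₀ ∪ Pfam M T₀).card := by
    have hd : Disjoint (Gfam M T₀) (Pfam M T₀) := by
      rw [Finset.disjoint_left]
      intro Y hY hY'
      have := card_eq_two_of_mem_Gfam hY
      rw [card_eq_three_of_mem_Pfam hY'] at this
      omega
    rw [Finset.card_union_of_disjoint hd, ← card_Gfam_add_card_par hT2]
    have := card_Pfam_ge hR hTq
    have h2 : 1 ≤ R - 3 := by omega
    nlinarith
  have hGPq : ((Nat.choose (Fs M T₀).card 2 : ℕ) : ℚ) ≤ ((Gfam M T₀ ∪ Pfam M T₀).card : ℚ) := by exact_mod_cast hGP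
  have hfpos : (0 : ℚ) < ((Nat.choose (Fs M T₀).card 2 : ℕ) : ℚ) := by
    have := card_Fs_ge_of_triple hR hTq
    exact_mod_cast Nat.choose_pos (by omega)
  by_cases h1 : crk M T₀ < 4
  · have : wE M T₀ S = 0 := by simp only [wE, if_pos h1]
    rw [this]
    split_ifs <;> positivity
  have h4p : 4 ≤ p₀ := le_trans (not_lt.1 h1) hp
  rw [if_pos h4p]
  unfold wE
  rw [if_neg h1, if_neg (by rw [hTc]; norm_num), if_pos (Finset.mem_union_left _ hG)]
  rw [price_two_four_eq, if_pos (by omega)]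
  have hc : ((Nat.choose (crk M T₀) 2 : ℕ) : ℚ) ≤ ((Nat.choose p₀ 2 : ℕ) : ℚ) := by
    exact_mod_cast Nat.choose_le_choose 2 hp
  have hc' : (crk M T₀ : ℚ) * ((crk M T₀ : ℚ) - 1) / 12 = ((Nat.choose (crk M T₀) 2 : ℕ) : ℚ) / 6 := by
    rw [Nat.cast_choose_two]; ring
  rw [hc']
  calc ((Nat.choose (crk M T₀) 2 : ℕ) : ℚ) / 6 / ((Gfam M T₀ ∪ Pfam M T₀).card : ℚ)
      ≤ ((Nat.choose (crk M T₀) 2 : ℕ) : ℚ) / 6 / ((Nat.choose (Fs M T₀).card 2 : ℕ) : ℚ) :=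
        div_le_div_of_nonneg_left (by positivity) hfpos hGPq
    _ = ((Nat.choose (crk M T₀) 2 : ℕ) : ℚ) / (6 * ((Nat.choose (Fs M T₀).card 2 : ℕ) : ℚ)) := by
        rw [div_div]
    _ ≤ ((Nat.choose p₀ 2 : ℕ) : ℚ) / (6 * ((Nat.choose (Fs M T₀).card 2 : ℕ) : ℚ)) :=
        div_le_div_of_nonneg_right hc (by positivity)

/-- **An inner share**: `≤ (C(p,2) − N)⁺/(6(ℓ−2)N)`. -/
theorem wE_inner_le {R : ℕ} (hR : M.eRank = R) (hsimple : ∀ T ⊆ M.E, T.encard ≤ 2 → M.Indep T)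
    {S T₀ B : Finset α} (hS : S ∈ Shadow.levelSet M 4) (h5 : S.card = 5) (hT : T₀ ⊆ S) (hTc : T₀.card = 3)
    (hT2 : M.eRk (T₀ : Set α) = 2) (hB : B ⊆ T₀) (hBc : B.card = 2) :
    wE M B S ≤ ((Nat.choose (pIn R (clF M T₀).card ((M.eRk ((Fs M T₀ : Finset α) : Set α)).toNat)) 2 -
      (Gfam M T₀).card : ℕ) : ℚ) / (6 * (((clF M T₀).card - 2 : ℕ) : ℚ) * ((Gfam M T₀).card : ℚ)) := by
  obtain ⟨hSg, hS4⟩ := Profile.mem_levelSet.1 hS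
  have hTq : T₀ ∈ Profile.Rq M 2 := Profile.mem_Rq.2 ⟨hT.trans hSg, hT2⟩
  obtain ⟨hcl, hp⟩ := crk_inner_le hR hsimple hTq hB hBc
  set p := pIn R (clF M T₀).card ((M.eRk ((Fs M T₀ : Finset α) : Set α)).toNat) with hpdef
  have hG := Gfam_inner_eq (M := M) hcl
  have hBg : B ⊆ gr M := (hB.trans hT).trans hSg
  have hSB : (S \ B).card = 3 := by rw [Finset.card_sdiff_of_subset (hB.trans hT), h5, hBc]
  -- the third point `z` of the triple
  have hz : (T₀ \ B).card = 1 := by rw [Finset.card_sdiff_of_subset hB, hTc, hBc]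
  obtain ⟨z, hzT⟩ := Finset.card_eq_one.1 hz
  have hzm : z ∈ T₀ \ B := by rw [hzT]; exact Finset.mem_singleton_self _
  rw [Finset.mem_sdiff] at hzm
  have hzcl : z ∈ clF M B \ B := by
    rw [Finset.mem_sdiff, hcl]; exact ⟨subset_clF_self (hT.trans hSg) hzm.1, hzm.2⟩
  have ht : 1 ≤ (clF M B \ B).card := Finset.card_pos.2 ⟨z, hzcl⟩
  have htc : (clF M B \ B).card = (clF M T₀).card - 2 := by
    rw [hcl, Finset.card_sdiff_of_subset (hB.trans (subset_clF_self (hT.trans hSg))), hBc]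
  -- `S ∖ B = insert z (S ∖ T₀) ∈ Ls_B`
  have hSBeq : S \ B = insert z (S \ T₀) := by
    ext w
    rw [Finset.mem_sdiff, Finset.mem_insert, Finset.mem_sdiff]
    constructor
    · rintro ⟨hwS, hwB⟩
      by_cases hwT : w ∈ T₀
      · left
        have : w ∈ T₀ \ B := Finset.mem_sdiff.2 ⟨hwT, hwB⟩
        rw [hzT, Finset.mem_singleton] at this; exact this
      · exact Or.inr ⟨hwS, hwT⟩
    · rintro (rfl | ⟨hwS, hwT⟩)
      · exact ⟨hT hzm.1, hzm.2⟩
      · exact ⟨hwS, fun h => hwT (hB h)⟩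
  have hL : S \ B ∈ Lfam M B := by
    rw [hSBeq]
    exact mem_Lfam.2 ⟨z, hzcl, S \ T₀, by rw [hG]; exact sdiff_mem_Gfam_of_triple hS h5 hT hTc hT2, rfl⟩
  have hNpos : 0 < (Gfam M T₀).card := Finset.card_pos.2 ⟨S \ T₀, sdiff_mem_Gfam_of_triple hS h5 hT hTc hT2⟩
  by_cases h4 : 4 ≤ crk M B
  · rw [wE_pair_eq_of_card_three hSB hBc h4, if_pos ht, if_pos hL, card_Lfam_eq B, hG, htc]
    -- `defic ≤ (C(p,2) − N)⁺ / 6`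
    have hd : defic M B ≤ ((Nat.choose p 2 - (Gfam M T₀).card : ℕ) : ℚ) / 6 := by
      unfold defic
      rw [hG, price_two_four_eq, if_pos h4]
      have hc' : (crk M B : ℚ) * ((crk M B : ℚ) - 1) / 12 = ((Nat.choose (crk M B) 2 : ℕ) : ℚ) / 6 := by
        rw [Nat.cast_choose_two]; ring
      rw [hc']
      apply max_le (by positivity)
      have hc : Nat.choose (crk M B) 2 ≤ Nat.choose p 2 := Nat.choose_le_choose 2 hp
      have : ((Nat.choose (crk M B) 2 : ℕ) : ℚ) - ((Gfam M T₀).card : ℚ) ≤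
          ((Nat.choose p 2 - (Gfam M T₀).card : ℕ) : ℚ) := by
        rcases Nat.le_total (Gfam M T₀).card (Nat.choose p 2) with h | h
        · rw [Nat.cast_sub h]
          have : ((Nat.choose (crk M B) 2 : ℕ) : ℚ) ≤ ((Nat.choose p 2 : ℕ) : ℚ) := by exact_mod_cast hc
          linarith
        · have h0 : Nat.choose p 2 - (Gfam M T₀).card = 0 := by omega
          rw [h0, Nat.cast_zero]
          have : ((Nat.choose (crk M B) 2 : ℕ) : ℚ) ≤ ((Gfam M T₀).card : ℚ) := by exact_mod_cast hc.trans h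
          linarith
      linarith
    have hden : (0 : ℚ) < (((clF M T₀).card - 2 : ℕ) : ℚ) * ((Gfam M T₀).card : ℚ) := by
      have : 0 < (clF M T₀).card - 2 := by omega
      positivity
    rw [Nat.cast_mul]
    calc defic M B / ((((clF M T₀).card - 2 : ℕ) : ℚ) * ((Gfam M T₀).card : ℚ))
        ≤ (((Nat.choose p 2 - (Gfam M T₀).card : ℕ) : ℚ) / 6) /
          ((((clF M T₀).card - 2 : ℕ) : ℚ) * ((Gfam M T₀).card : ℚ)) := div_le_div_of_nonneg_right hd hden.le
      _ = ((Nat.choose p 2 - (Gfam M T₀).card : ℕ) : ℚ) /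
          (6 * (((clF M T₀).card - 2 : ℕ) : ℚ) * ((Gfam M T₀).card : ℚ)) := by
          rw [div_div, mul_assoc]
  · have h4' : crk M B < 4 := by omega
    have : wE M B S = 0 := by simp only [wE, if_pos h4']
    rw [this]
    positivity

end CapETripleB
end PercRepro
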